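import Literature.AlgebraicGeometry.Resolution.WeakJacobianCondition
import Literature.AlgebraicGeometry.Resolution.DerivativeIdealsLocalization
import Mathlib.RingTheory.MvPolynomial.Localization
import HarnessLib

/-!
# (WJ) is inherited by localisations (Matsumura, proof of Thm. 32.6, first sentence)

Topic: `Literature/AlgebraicGeometry/Resolution`. First brick of the decomposition of the named
fact `Matsumura1987_32_6` (`WeakJacobianCondition.lean`: H. Mizutani's theorem, Matsumura
Thm. 32.6 — a regular ring `R` such that (WJ) holds in every `R[X_1, …, X_n]` is a G-ring) along
its printed proof (p. 260), whose first sentence is "Since (WJ) is inherited by any localisation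
we can assume that `R` is local." Everything here is PROVED (no definitions, no named facts):

* `IsWeakJacobianAt.of_isLocalization`, `IsWeakJacobian.of_isLocalization` — **(WJ) passes to
  localisations**: an ideal `P` of `T⁻¹R` has the same height as `P ∩ R`
  (`IsLocalization.height_under`); derivations `D ∈ Der(R) = Der_ℤ(R, R)` extend to `T⁻¹R`
  (Matsumura Ex. 25.3: "a derivation `D` induces a derivation of `A_S` by means of
  `D(a/s) = (D(a)·s - a·D(s))/s²`" — in the tree this is
  `exists_derivation_extend_of_isLocalization` of `DerivativeIdealsLocalization.lean`, for an
  arbitrary base ring `k`, used here with `k = ℤ`), and `det(D_i f_j) ∉ P ∩ R` gives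
  `det(D̃_i (f_j/1)) = det(D_i f_j)/1 ∉ P`.
* `IsWeakJacobian.mvPolynomial_of_isLocalization` — in particular (WJ) for `R[X_1, …, X_n]`
  gives (WJ) for `(T⁻¹R)[X_1, …, X_n] = T⁻¹(R[X_1, …, X_n])` (Mathlib's
  `MvPolynomial.isLocalization`), and `IsWeakJacobian.mvPolynomial_localizationAtPrime` is the
  form used in the proof of Thm. 32.6 with `T⁻¹R = R_𝔭`.

## Sources

* H. Matsumura, *Commutative Ring Theory*, CUP 1986 (PDF pages of the held copy in brackets):
  Ex. 25.3 p. 197 [215] (derivations extend to localisations and completions); §30 p. 238 [256]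
  ((WJ)); proof of Thm. 32.6, p. 260 [278]. [Matsumura1987]
-/

noncomputable section

namespace Literature.AlgebraicGeometry.Resolution

universe u v

/-! ## (WJ) passes to localisations -/

section WJ

variable {R : Type u} {A : Type v} [CommRing R] [CommRing A] [Algebra R A]
  (T : Submonoid R) [IsLocalization T A]

include T in
/-- (WJ) at `P ∩ R` in `R` gives (WJ) at `P` in `T⁻¹R` (derivations extended by
`exists_derivation_extend_of_isLocalization`, Matsumura Ex. 25.3).
[cite: Matsumura1987, proof of Thm. 32.6, p. 260 ("(WJ) is inherited by any localisation")] -/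
theorem IsWeakJacobianAt.of_isLocalization {P : Ideal A}
    (h : IsWeakJacobianAt (P.comap (algebraMap R A))) : IsWeakJacobianAt P := by
  obtain ⟨r, hr, D, f, hf, hdet⟩ := h
  choose D' hD' using fun i => exists_derivation_extend_of_isLocalization ℤ A T (D i)
  refine ⟨r, ?_, D', fun j => algebraMap R A (f j), fun j => Ideal.mem_comap.1 (hf j), ?_⟩
  · rw [← hr]
    exact (IsLocalization.height_under T P).symm
  · have hM : (Matrix.of fun i j => D' i (algebraMap R A (f j))).det =
        algebraMap R A (Matrix.of fun i j => D i (f j)).det := by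
      rw [RingHom.map_det]
      congr 1
      ext i j
      simp [hD']
    rw [hM]
    exact fun hmem => hdet (Ideal.mem_comap.2 hmem)

include T in
/-- **(WJ) is inherited by any localisation.** [cite: Matsumura1987, proof of Thm. 32.6,
p. 260] -/
theorem IsWeakJacobian.of_isLocalization (h : IsWeakJacobian R) : IsWeakJacobian A :=
  fun P _ => IsWeakJacobianAt.of_isLocalization T (h (P.comap (algebraMap R A)))

attribute [local instance] MvPolynomial.algebraMvPolynomial in
include T in
/-- (WJ) for `R[X_1, …, X_n]` gives (WJ) for `(T⁻¹R)[X_1, …, X_n]`, a localisation of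
`R[X_1, …, X_n]`. [cite: Matsumura1987, proof of Thm. 32.6, p. 260] -/
theorem IsWeakJacobian.mvPolynomial_of_isLocalization (n : ℕ)
    (h : IsWeakJacobian (MvPolynomial (Fin n) R)) : IsWeakJacobian (MvPolynomial (Fin n) A) :=
  IsWeakJacobian.of_isLocalization (T.map (MvPolynomial.C (σ := Fin n))) h

/-- The hypothesis of Thm. 32.6 localises: if (WJ) holds in `R[X_1, …, X_n]` for every `n`, then
it holds in `R_𝔭[X_1, …, X_n]` for every prime `𝔭` and every `n`. [cite: Matsumura1987, proof of
Thm. 32.6, p. 260] -/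
theorem IsWeakJacobian.mvPolynomial_localizationAtPrime (p : Ideal R) [p.IsPrime]
    (h : ∀ n : ℕ, IsWeakJacobian (MvPolynomial (Fin n) R)) (n : ℕ) :
    IsWeakJacobian (MvPolynomial (Fin n) (Localization.AtPrime p)) :=
  IsWeakJacobian.mvPolynomial_of_isLocalization p.primeCompl n (h n)

end WJ

end Literature.AlgebraicGeometry.Resolution

end
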